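import Literature.Analysis.Hypoelliptic.KohnIteration
import HarnessLib

/-!
# Kohn's iteration, II: the `X₀`-step and the base case `S(X₀, 1/2)`

Analysis/Hypoelliptic support file, twelfth piece of the Fourier-side toolkit serving the
discharge of `Literature.Analysis.Distribution.Hormander1967_thm11` by Kohn's method
(M. Taylor, *Pseudodifferential Operators* (1981), Ch. XV §1, (1.35)–(1.52)). Continues
`KohnIteration.lean`.

* **The `X₀`-step** (Taylor (1.43), (1.49), (1.50)): `S(F', ε')` with `0 < ε' ≤ 1` implies
  `S([X₀, F'], ε'/4)`. The drift `X₀` is eliminated through `X₀ = P - ∑ X_j² - c` on both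
  sides of the pairing `⟨[X₀, F'] u, Λ^{2ε-2} [X₀, F'] u⟩`; the dangerous term
  `⟨X_j F' u, X_j Λ^{2ε-2}[X₀,F'] u⟩` is controlled by the energy inequality applied to
  `w = T† F' u` (Taylor (1.38)), which costs the factor `4` in the exponent.
* **The base case** `S(X₀, 1/2)` (Taylor (1.52)).

All estimates are funnelled through the master quantity
`Q u = ‖Pu‖₀ + ‖u‖₀ + ‖F'u‖_{4ε-1} + ∑_j ‖X_j u‖₀ + ∑_j ‖[X_j, F'] u‖_{2ε-1}`.

## References

* M. E. Taylor, *Pseudodifferential Operators* (1981), Ch. XV §1, (1.35)–(1.52).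
-/

noncomputable section

open MeasureTheory Set Filter Function
open scoped ENNReal NNReal Topology ComplexConjugate InnerProductSpace BigOperators

namespace Literature.Analysis.Hypoelliptic

variable {V : Type*} [NormedAddCommGroup V] [InnerProductSpace ℝ V] [FiniteDimensional ℝ V]
  [MeasurableSpace V] [BorelSpace V]

/-! ### Preliminaries -/

/-- Real norms are subadditive on `Nice`. [folklore] -/
theorem rn_add_le (t : ℝ) {F G : V → ℂ} (hF : Nice F) (hG : Nice G) :
    rn t (fun ξ => F ξ + G ξ) ≤ rn t F + rn t G := by
  unfold rn
  rw [← ENNReal.toReal_add (hF.2 t).ne (hG.2 t).ne]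
  exact ENNReal.toReal_mono (ENNReal.add_ne_top.2 ⟨(hF.2 t).ne, (hG.2 t).ne⟩)
    (wnorm_add_le hF.1 hG.1)

/-- Real norms of differences on `Nice`. [folklore] -/
theorem rn_sub_le (t : ℝ) {F G : V → ℂ} (hF : Nice F) (hG : Nice G) :
    rn t (fun ξ => F ξ - G ξ) ≤ rn t F + rn t G := by
  unfold rn
  rw [← ENNReal.toReal_add (hF.2 t).ne (hG.2 t).ne]
  exact ENNReal.toReal_mono (ENNReal.add_ne_top.2 ⟨(hF.2 t).ne, (hG.2 t).ne⟩)
    (wnorm_sub_le hF.1 hG.1)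

namespace Sym

/-- The adjoint identity with the operator on the right:
`⟨F, T H⟩ = ⟨T† F, H⟩` for plain certified `T`. [folklore] -/
theorem Plain.pairing_apply_right {T : Sym V} (hpl : Plain T) (hT : Cert T) {F H : V → ℂ}
    (hF : Nice F) (hH : Nice H) : pairing F (apply T H) = pairing (apply (adj T) F) H := by
  rw [pairing_comm, hpl.pairing_apply hT hH hF, ← pairing_comm]

end Sym

namespace Field

open Sym

omit [FiniteDimensional ℝ V] [MeasurableSpace V] [BorelSpace V] in
/-- The bracket of nonempty fields is nonempty. [folklore] -/
theorem bracket_ne_nil {X Y : Field V} (hX : X ≠ []) (hY : Y ≠ []) : bracket X Y ≠ [] := by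
  obtain ⟨p, X', rfl⟩ := List.exists_cons_of_ne_nil hX
  obtain ⟨q, Y', rfl⟩ := List.exists_cons_of_ne_nil hY
  simp [Field.bracket]

/-- `F' (X v) = X (F' v) - [X, F'] v` on `Nice` (the bracket as an operator identity).
[folklore] -/
theorem apply_swap {X F' : Field V} (hX : IsField X) (hcX : CertF X) (hF : IsField F')
    (hcF : CertF F') {v : V → ℂ} (hv : Nice v) :
    (toSym F').apply ((toSym X).apply v) =
      fun ξ => (toSym X).apply ((toSym F').apply v) ξ - (toSym (bracket X F')).apply v ξ := by
  have h := comm_toSym hX hcX hF hcF v hv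
  rw [apply_comm] at h
  ext ξ
  exact eq_sub_of_add_eq ((add_comm _ _).trans (sub_eq_iff_eq_add.1 (congrFun h ξ)).symm)

end Field

namespace HData

open Sym Field

variable (d : HData V)

/-- `X₀ H = P H - (∑ X_j²) H - C H` pointwise. [folklore] -/
theorem apply_X0s (H : V → ℂ) :
    d.X0s.apply H = fun ξ => d.opP.apply H ξ - d.sqSum.apply H ξ - d.C.apply H ξ := by
  ext ξ
  simp only [opP, apply_add]
  ring

/-- `X_j (T u) = T (X_j u) + (fcomm X_j T) u` pointwise, for `T` of level `≤ 1`. [folklore] -/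
theorem apply_Xs_of_comm (j : Fin d.J) {T : Sym V} (hT : Cert T) (hlev : lev T ≤ 1) {u : V → ℂ}
    (hu : Nice u) :
    (d.Xs j).apply (T.apply u) = fun ξ => T.apply ((d.Xs j).apply u) ξ + (fcomm (d.X j) T).apply u ξ := by
  have h := comm_fcomm (d.isField j) (d.certF j) hlev hT u hu
  rw [apply_comm] at h
  ext ξ
  exact (sub_eq_iff_eq_add.1 (congrFun h ξ)).trans (add_comm _ _)

/-! ### The energy inequality applied to `w = T† F' u` (Taylor (1.38)) -/

/-- For plain certified `S` of order `≤ 2ε`: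
`∑_j ‖X_j (S u)‖₀² ≤ C (‖Pu‖₀ ‖Su‖_{2ε} + ‖Su‖_{2ε} (∑_i ‖X_i u‖₀ + ‖u‖₀) + ‖Su‖₀²)`.
[folklore] -/
theorem energy_S {S : Sym V} (hS : Cert S) (hpl : Plain S) {ε : ℝ} (hord : ord S ≤ 2 * ε) :
    ∃ C : ℝ, 0 ≤ C ∧ ∀ u : V → ℂ, Nice u →
      (∑ j, rn 0 ((d.Xs j).apply (S.apply u)) ^ 2) ≤
        C * (rn 0 (d.opP.apply u) * rn (2 * ε) (S.apply u) +
          rn (2 * ε) (S.apply u) * ((∑ i, rn 0 ((d.Xs i).apply u)) + rn 0 u) +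
          rn 0 (S.apply u) ^ 2) := by
  obtain ⟨K, hK, hE⟩ := d.energy
  obtain ⟨C₁, hC₁, h₁⟩ := hS.rn_le (t := 0) (t' := -(2 * ε)) (by linarith)
  obtain ⟨C₂, hC₂, h₂⟩ := d.lemmaC' hS hpl
  refine ⟨2 * C₁ + 2 * C₂ + K, by positivity, fun u hu => ?_⟩
  have hw : Nice (S.apply u) := hS.nice_apply hu
  have hPu : Nice (d.opP.apply u) := d.cert_opP.nice_apply hu
  refine (hE _ hw).trans ?_
  -- `⟨P w, w⟩ = ⟨S (P u), w⟩ + ⟨[P, S] u, w⟩`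
  have hsplit : d.opP.apply (S.apply u) =
      fun ξ => S.apply (d.opP.apply u) ξ + (Sym.comm d.opP S).apply u ξ := by
    ext ξ; simp only [apply_comm]; ring
  rw [hsplit, pairing_add_left ((hS.nice_apply hPu).inH (-(2 * ε)))
    ((((cert_comm_iff _ _).2 ⟨d.cert_opP, hS⟩).nice_apply hu).inH (-(2 * ε)))
    (by simpa using hw.inH (2 * ε))]
  have b₁ : ‖pairing (S.apply (d.opP.apply u)) (S.apply u)‖ ≤
      C₁ * rn 0 (d.opP.apply u) * rn (2 * ε) (S.apply u) := by
    have h := norm_pairing_le_rn (-(2 * ε)) (hS.nice_apply hPu) hw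
    rw [neg_neg] at h
    exact h.trans (by
      exact (mul_le_mul_of_nonneg_right (h₁ _ hPu) (rn_nonneg (2 * ε) (S.apply u))).trans_eq (by ring))
  have b₂ : ‖pairing ((Sym.comm d.opP S).apply u) (S.apply u)‖ ≤
      rn (2 * ε) (S.apply u) * (C₂ * ((∑ i, rn 0 ((d.Xs i).apply u)) + rn 0 u)) :=
    (h₂ _ u hw hu).trans (mul_le_mul_of_nonneg_right (rn_mono hord hw)
      (mul_nonneg hC₂ (add_nonneg (Finset.sum_nonneg fun _ _ => rn_nonneg _ _) (rn_nonneg _ _))))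
  have hre := (abs_re_le_norm _).trans ((norm_add_le _ _).trans (add_le_add b₁ b₂))
  have hp0 := rn_nonneg 0 (d.opP.apply u); have hw2 := rn_nonneg (2 * ε) (S.apply u)
  have hn0 := rn_nonneg 0 u; have hw0 := rn_nonneg 0 (S.apply u)
  have hS0 := Finset.sum_nonneg fun i (_ : i ∈ Finset.univ) => rn_nonneg 0 ((d.Xs i).apply u)
  have e1 : 0 ≤ (2 * C₂ + K) * (rn 0 (d.opP.apply u) * rn (2 * ε) (S.apply u)) :=
    mul_nonneg (by positivity) (mul_nonneg hp0 hw2)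
  have e2 : 0 ≤ (2 * C₁ + K) * (rn (2 * ε) (S.apply u) *
      ((∑ i, rn 0 ((d.Xs i).apply u)) + rn 0 u)) :=
    mul_nonneg (by positivity) (mul_nonneg hw2 (add_nonneg hS0 hn0))
  have e3 : 0 ≤ (2 * C₁ + 2 * C₂) * rn 0 (S.apply u) ^ 2 := mul_nonneg (by positivity) (sq_nonneg _)
  nlinarith only [hre, e1, e2, e3]

/-! ### The `X₀`-step: the setting -/

/-- The master quantity of the `X₀`-step:
`Q u = ‖Pu‖₀ + ‖u‖₀ + ‖F'u‖_{4ε-1} + ∑_j ‖X_j u‖₀ + ∑_j ‖[X_j,F'] u‖_{2ε-1}`. [folklore] -/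
def Qx (F' : Field V) (ε : ℝ) (u : V → ℂ) : ℝ :=
  rn 0 (d.opP.apply u) + rn 0 u + rn (4 * ε - 1) ((toSym F').apply u) +
    (∑ j, rn 0 ((d.Xs j).apply u)) + ∑ j, rn (2 * ε - 1) ((toSym (bracket (d.X j) F')).apply u)

/-- (structural lemma) [folklore] -/
theorem Qx_nonneg (F' : Field V) (ε : ℝ) (u : V → ℂ) : 0 ≤ d.Qx F' ε u :=
  add_nonneg (add_nonneg (add_nonneg (add_nonneg (rn_nonneg _ _) (rn_nonneg _ _)) (rn_nonneg _ _))
    (Finset.sum_nonneg fun _ _ => rn_nonneg _ _)) (Finset.sum_nonneg fun _ _ => rn_nonneg _ _)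

/-- (structural lemma) [folklore] -/
theorem rn_P_le_Qx (F' : Field V) (ε : ℝ) (u : V → ℂ) : rn 0 (d.opP.apply u) ≤ d.Qx F' ε u := by
  unfold Qx
  have := rn_nonneg 0 u; have := rn_nonneg (4 * ε - 1) ((toSym F').apply u)
  have := Finset.sum_nonneg fun j (_ : j ∈ Finset.univ) => rn_nonneg 0 ((d.Xs j).apply u)
  have := Finset.sum_nonneg fun j (_ : j ∈ Finset.univ) =>
    rn_nonneg (2 * ε - 1) ((toSym (bracket (d.X j) F')).apply u)
  linarith

/-- (structural lemma) [folklore] -/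
theorem rn_u_le_Qx (F' : Field V) (ε : ℝ) (u : V → ℂ) : rn 0 u ≤ d.Qx F' ε u := by
  unfold Qx
  have := rn_nonneg 0 (d.opP.apply u); have := rn_nonneg (4 * ε - 1) ((toSym F').apply u)
  have := Finset.sum_nonneg fun j (_ : j ∈ Finset.univ) => rn_nonneg 0 ((d.Xs j).apply u)
  have := Finset.sum_nonneg fun j (_ : j ∈ Finset.univ) =>
    rn_nonneg (2 * ε - 1) ((toSym (bracket (d.X j) F')).apply u)
  linarith

/-- (structural lemma) [folklore] -/
theorem rn_F4_le_Qx (F' : Field V) (ε : ℝ) (u : V → ℂ) :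
    rn (4 * ε - 1) ((toSym F').apply u) ≤ d.Qx F' ε u := by
  unfold Qx
  have := rn_nonneg 0 (d.opP.apply u); have := rn_nonneg 0 u
  have := Finset.sum_nonneg fun j (_ : j ∈ Finset.univ) => rn_nonneg 0 ((d.Xs j).apply u)
  have := Finset.sum_nonneg fun j (_ : j ∈ Finset.univ) =>
    rn_nonneg (2 * ε - 1) ((toSym (bracket (d.X j) F')).apply u)
  linarith

/-- (structural lemma) [folklore] -/
theorem rn_F2_le_Qx {F' : Field V} (hcF : CertF F') {ε : ℝ} (hε : 0 ≤ ε) {u : V → ℂ}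
    (hu : Nice u) : rn (2 * ε - 1) ((toSym F').apply u) ≤ d.Qx F' ε u :=
  (rn_mono (by linarith) (hcF.cert_toSym.nice_apply hu)).trans (d.rn_F4_le_Qx F' ε u)

/-- (structural lemma) [folklore] -/
theorem sum_rn_X_le_Qx (F' : Field V) (ε : ℝ) (u : V → ℂ) :
    (∑ j, rn 0 ((d.Xs j).apply u)) ≤ d.Qx F' ε u := by
  unfold Qx
  have := rn_nonneg 0 (d.opP.apply u); have := rn_nonneg 0 u
  have := rn_nonneg (4 * ε - 1) ((toSym F').apply u)
  have := Finset.sum_nonneg fun j (_ : j ∈ Finset.univ) =>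
    rn_nonneg (2 * ε - 1) ((toSym (bracket (d.X j) F')).apply u)
  linarith

/-- (structural lemma) [folklore] -/
theorem rn_X_le_Qx (F' : Field V) (ε : ℝ) (u : V → ℂ) (j : Fin d.J) :
    rn 0 ((d.Xs j).apply u) ≤ d.Qx F' ε u :=
  (Finset.single_le_sum (f := fun j => rn 0 ((d.Xs j).apply u)) (fun _ _ => rn_nonneg _ _)
    (Finset.mem_univ j)).trans (d.sum_rn_X_le_Qx F' ε u)

/-- (structural lemma) [folklore] -/
theorem rn_br_le_Qx (F' : Field V) (ε : ℝ) (u : V → ℂ) (j : Fin d.J) :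
    rn (2 * ε - 1) ((toSym (bracket (d.X j) F')).apply u) ≤ d.Qx F' ε u := by
  unfold Qx
  have := rn_nonneg 0 (d.opP.apply u); have := rn_nonneg 0 u
  have := rn_nonneg (4 * ε - 1) ((toSym F').apply u)
  have := Finset.sum_nonneg fun j (_ : j ∈ Finset.univ) => rn_nonneg 0 ((d.Xs j).apply u)
  have h1 := Finset.single_le_sum (f := fun j => rn (2 * ε - 1) ((toSym (bracket (d.X j) F')).apply u))
    (fun _ _ => rn_nonneg _ _) (Finset.mem_univ j)
  linarith

/-! ### Piece A: `⟨X_j F'u, X_j (T u)⟩` (Taylor (1.37)–(1.41)) -/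

/-- **Piece A** (Taylor (1.41)): for plain certified `T` with `ord T ≤ 2ε - 1`,
`|⟨X_j F'u, X_j (T u)⟩| ≤ C · Q(u)²`. [folklore] -/
theorem pieceA (j : Fin d.J) {F' : Field V} (hF : IsField F') (hcF : CertF F') {ε : ℝ}
    (hε : 0 ≤ ε) {T : Sym V} (hT : Cert T) (hpl : Plain T) (hord : ord T ≤ 2 * ε - 1) :
    ∃ C : ℝ, 0 ≤ C ∧ ∀ u : V → ℂ, Nice u →
      ‖pairing ((d.Xs j).apply ((toSym F').apply u)) ((d.Xs j).apply (T.apply u))‖ ≤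
        C * d.Qx F' ε u ^ 2 := by
  set σ : ℝ := 2 * ε - 1 with hσ
  have hX := d.isField j
  have hcX := d.certF j
  have hl0 : lev T ≤ 1 := by simp [hpl.lev_eq]
  -- `fc = fcomm X_j T`, `T† = adj T`, `fc† = fcomm X_j T†`, `S = T† ∘ F'`
  have hcfc : Cert (fcomm (d.X j) T) := hcX.fcomm_cert hX hT
  have hlfc : lev (fcomm (d.X j) T) ≤ 1 := (lev_fcomm_le hX T).trans (by simp [hpl.lev_eq])
  have hofc : ord (fcomm (d.X j) T) ≤ σ := (ord_fcomm_le hX (d.ne j) T).trans hord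
  have hcTa : Cert (adj T) := hT.adjoint
  have hplTa : Plain (adj T) := hpl.adjoint
  have hlTa : lev (adj T) ≤ 1 := by simp [hplTa.lev_eq]
  have hoTa : ord (adj T) ≤ σ := by rw [ord_adj]; exact hord
  have hcfca : Cert (fcomm (d.X j) (adj T)) := hcX.fcomm_cert hX hcTa
  have hofca : ord (fcomm (d.X j) (adj T)) ≤ σ := (ord_fcomm_le hX (d.ne j) _).trans hoTa
  set S : Sym V := comp (adj T) (toSym F') with hS
  have hcS : Cert S := ⟨hcTa, hcF.cert_toSym⟩
  have hplS : Plain S := ⟨hplTa, hF.plain_toSym⟩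
  have hoS : ord S ≤ 2 * ε := by
    have := hF.ord_toSym_le; simp only [hS, ord_comp]; linarith
  -- constants
  obtain ⟨CA, hCA, hA⟩ := lemmaA hX hcX (d.isReal j) (d.ne j) hcfc hlfc hofc
  obtain ⟨C₁, hC₁, h₁⟩ := hcfca.rn_le (t := σ) (t' := 0) (by linarith)
  obtain ⟨C₂, hC₂, h₂⟩ := hcTa.rn_le (t := σ) (t' := 0) (by linarith)
  obtain ⟨C₃, hC₃, h₃⟩ := hcTa.rn_le (t := 4 * ε - 1) (t' := 2 * ε) (by linarith)
  obtain ⟨CE, hCE, hE⟩ := d.energy_S hcS hplS hoS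
  refine ⟨2 * CA + C₁ + (CE * (3 * C₃ + C₂ ^ 2) + 1), by positivity, fun u hu => ?_⟩
  set Q := d.Qx F' ε u with hQ
  have hQ0 : 0 ≤ Q := d.Qx_nonneg F' ε u
  have hG : Nice ((toSym F').apply u) := hcF.cert_toSym.nice_apply hu
  have hXG : Nice ((d.Xs j).apply ((toSym F').apply u)) := (d.cert_Xs j).nice_apply hG
  have hXu : Nice ((d.Xs j).apply u) := (d.cert_Xs j).nice_apply hu
  -- basic sizes
  have hf : rn σ ((toSym F').apply u) ≤ Q := d.rn_F2_le_Qx hcF hε hu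
  have hf4 : rn (4 * ε - 1) ((toSym F').apply u) ≤ Q := d.rn_F4_le_Qx F' ε u
  have hx : rn 0 ((d.Xs j).apply u) ≤ Q := d.rn_X_le_Qx F' ε u j
  have hn : rn 0 u ≤ Q := d.rn_u_le_Qx F' ε u
  have hp : rn 0 (d.opP.apply u) ≤ Q := d.rn_P_le_Qx F' ε u
  have hsx : (∑ i, rn 0 ((d.Xs i).apply u)) ≤ Q := d.sum_rn_X_le_Qx F' ε u
  -- split `X_j (T u) = T (X_j u) + fc u`
  rw [d.apply_Xs_of_comm j hT hl0 hu,
    pairing_add_right (hXG.inH 0) (by simpa using (hT.nice_apply hXu).inH 0)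
      (by simpa using (hcfc.nice_apply hu).inH 0)]
  -- the `fc` term (Lemma A)
  have bfc := hA _ u hG hu
  -- the `T (X_j u)` term: move `T` across
  rw [hpl.pairing_apply_right hT hXG hXu]
  -- `T† (X_j G) = X_j (T† G) - fc† G`
  have hswap : (adj T).apply ((d.Xs j).apply ((toSym F').apply u)) =
      fun ξ => (d.Xs j).apply ((adj T).apply ((toSym F').apply u)) ξ -
        (fcomm (d.X j) (adj T)).apply ((toSym F').apply u) ξ := by
    have h := comm_fcomm hX hcX hlTa hcTa _ hG
    rw [apply_comm] at h
    ext ξ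
    exact eq_sub_of_add_eq ((add_comm _ _).trans (sub_eq_iff_eq_add.1 (congrFun h ξ)).symm)
  have hw : Nice ((adj T).apply ((toSym F').apply u)) := hcTa.nice_apply hG
  have hXw : Nice ((d.Xs j).apply ((adj T).apply ((toSym F').apply u))) :=
    (d.cert_Xs j).nice_apply hw
  have hfcaG : Nice ((fcomm (d.X j) (adj T)).apply ((toSym F').apply u)) := hcfca.nice_apply hG
  rw [hswap, pairing_sub_left (hXw.inH 0) (hfcaG.inH 0) (by simpa using hXu.inH 0)]
  -- bounds of the two new terms
  have bfca : ‖pairing ((fcomm (d.X j) (adj T)).apply ((toSym F').apply u)) ((d.Xs j).apply u)‖ ≤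
      C₁ * Q * Q := by
    have h := norm_pairing_le_rn 0 hfcaG hXu
    rw [neg_zero] at h
    refine h.trans ?_
    have h1 : rn 0 ((fcomm (d.X j) (adj T)).apply ((toSym F').apply u)) ≤ C₁ * Q :=
      (h₁ _ hG).trans (mul_le_mul_of_nonneg_left hf hC₁)
    calc _ ≤ (C₁ * Q) * Q := mul_le_mul h1 hx (rn_nonneg _ _) (mul_nonneg hC₁ hQ0)
      _ = C₁ * Q * Q := by ring
  have bXw : ‖pairing ((d.Xs j).apply ((adj T).apply ((toSym F').apply u))) ((d.Xs j).apply u)‖ ≤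
      (CE * (3 * C₃ + C₂ ^ 2) + 1) * Q ^ 2 := by
    have h := norm_pairing_le_rn 0 hXw hXu
    rw [neg_zero] at h
    -- energy for `w = S u`
    have hSu : S.apply u = (adj T).apply ((toSym F').apply u) := rfl
    have hEw := hE u hu
    rw [hSu] at hEw
    have hsq : rn 0 ((d.Xs j).apply ((adj T).apply ((toSym F').apply u))) ^ 2 ≤
        ∑ i, rn 0 ((d.Xs i).apply ((adj T).apply ((toSym F').apply u))) ^ 2 :=
      Finset.single_le_sum (f := fun i => rn 0 ((d.Xs i).apply ((adj T).apply ((toSym F').apply u))) ^ 2)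
        (fun _ _ => sq_nonneg _) (Finset.mem_univ j)
    have hw2 : rn (2 * ε) ((adj T).apply ((toSym F').apply u)) ≤ C₃ * Q :=
      (h₃ _ hG).trans (mul_le_mul_of_nonneg_left hf4 hC₃)
    have hw0 : rn 0 ((adj T).apply ((toSym F').apply u)) ≤ C₂ * Q :=
      (h₂ _ hG).trans (mul_le_mul_of_nonneg_left hf hC₂)
    set a := rn 0 ((d.Xs j).apply ((adj T).apply ((toSym F').apply u))) with ha
    have ha0 : 0 ≤ a := rn_nonneg _ _
    have hx0 := rn_nonneg 0 ((d.Xs j).apply u)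
    have hw20 := rn_nonneg (2 * ε) ((adj T).apply ((toSym F').apply u))
    have hw00 := rn_nonneg 0 ((adj T).apply ((toSym F').apply u))
    have ha2 : a ^ 2 ≤ CE * (3 * C₃ + C₂ ^ 2) * Q ^ 2 := by
      refine (hsq.trans hEw).trans ?_
      have e1 : rn 0 (d.opP.apply u) * rn (2 * ε) ((adj T).apply ((toSym F').apply u)) ≤ Q * (C₃ * Q) :=
        mul_le_mul hp hw2 hw20 hQ0
      have e2 : rn (2 * ε) ((adj T).apply ((toSym F').apply u)) *
          ((∑ i, rn 0 ((d.Xs i).apply u)) + rn 0 u) ≤ (C₃ * Q) * (Q + Q) :=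
        mul_le_mul hw2 (add_le_add hsx hn) (add_nonneg (Finset.sum_nonneg fun _ _ => rn_nonneg _ _)
          (rn_nonneg _ _)) (mul_nonneg hC₃ hQ0)
      have e3 : rn 0 ((adj T).apply ((toSym F').apply u)) ^ 2 ≤ (C₂ * Q) ^ 2 :=
        pow_le_pow_left₀ hw00 hw0 2
      have hs' : rn 0 (d.opP.apply u) * rn (2 * ε) ((adj T).apply ((toSym F').apply u)) +
          rn (2 * ε) ((adj T).apply ((toSym F').apply u)) *
            ((∑ i, rn 0 ((d.Xs i).apply u)) + rn 0 u) +
          rn 0 ((adj T).apply ((toSym F').apply u)) ^ 2 ≤ (3 * C₃ + C₂ ^ 2) * Q ^ 2 := by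
        linarith [e1, e2, e3]
      calc _ ≤ CE * ((3 * C₃ + C₂ ^ 2) * Q ^ 2) := mul_le_mul_of_nonneg_left hs' hCE
        _ = _ := by ring
    -- `a x ≤ (a² + x²)/2 ≤ …`
    have e4 : rn 0 ((d.Xs j).apply u) ^ 2 ≤ Q ^ 2 := pow_le_pow_left₀ hx0 hx 2
    nlinarith only [h, sq_nonneg (a - rn 0 ((d.Xs j).apply u)), ha2, e4, ha0, hx0,
      mul_nonneg (mul_nonneg hCE (by positivity : (0:ℝ) ≤ 3 * C₃ + C₂ ^ 2)) (sq_nonneg Q), sq_nonneg Q]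
  calc _ ≤ ‖pairing ((d.Xs j).apply ((adj T).apply ((toSym F').apply u))) ((d.Xs j).apply u)‖ +
        ‖pairing ((fcomm (d.X j) (adj T)).apply ((toSym F').apply u)) ((d.Xs j).apply u)‖ +
        ‖pairing ((d.Xs j).apply ((toSym F').apply u)) ((fcomm (d.X j) T).apply u)‖ :=
        (norm_add_le _ _).trans (add_le_add (norm_sub_le _ _) le_rfl)
    _ ≤ (CE * (3 * C₃ + C₂ ^ 2) + 1) * Q ^ 2 + C₁ * Q * Q +
        rn σ ((toSym F').apply u) * (CA * (rn 0 ((d.Xs j).apply u) + rn 0 u)) :=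
        add_le_add (add_le_add bXw bfca) bfc
    _ ≤ _ := by
        have := rn_nonneg σ ((toSym F').apply u)
        nlinarith [mul_le_mul hf (add_le_add hx hn) (add_nonneg (rn_nonneg _ _) (rn_nonneg _ _)) hQ0]


/-! ### Piece B: Term I `⟨X₀ F'u, T u⟩` (Taylor (1.35)–(1.43)) -/

/-- `⟨G, (∑ X_j²) H⟩ = ∑_j ⟨G, X_j X_j H⟩`. [folklore] -/
theorem pairing_sqSum_apply_right {G H : V → ℂ} (hG : Nice G) (hH : Nice H) :
    pairing G (d.sqSum.apply H) = ∑ j, pairing G ((d.Xs j).apply ((d.Xs j).apply H)) := by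
  rw [pairing_comm, d.pairing_sqSum_apply hH hG, map_sum]
  exact Finset.sum_congr rfl fun j _ => (pairing_comm _ _).symm

/-- `⟨G, X_j W⟩ = -⟨X_j G, W⟩ - ⟨G, d_j W⟩` (integration by parts, rearranged). [folklore] -/
theorem pairing_Xs_right (j : Fin d.J) {G W : V → ℂ} (hG : Nice G) (hW : Nice W) :
    pairing G ((d.Xs j).apply W) = -pairing ((d.Xs j).apply G) W - pairing G ((d.divX j).apply W) := by
  have h := Field.pairing_real (d.isField j) (d.certF j) (d.isReal j) hW hG
  unfold Xs divX
  linear_combination h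

/-- **Term I** (Taylor (1.43)): for plain certified `T` with `ord T ≤ 2ε - 1`,
`|⟨X₀ F'u, T u⟩| ≤ C · Q(u)²`. [folklore] -/
theorem termI {F' : Field V} (hF : IsField F') (hcF : CertF F') {ε : ℝ} (hε : 0 ≤ ε)
    {T : Sym V} (hT : Cert T) (hpl : Plain T) (hord : ord T ≤ 2 * ε - 1) :
    ∃ C : ℝ, 0 ≤ C ∧ ∀ u : V → ℂ, Nice u →
      ‖pairing (d.X0s.apply ((toSym F').apply u)) (T.apply u)‖ ≤ C * d.Qx F' ε u ^ 2 := by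
  set σ : ℝ := 2 * ε - 1 with hσ
  have hl0 : lev T ≤ 1 := by simp [hpl.lev_eq]
  have hcfc : ∀ j, Cert (fcomm (d.X j) T) := fun j => (d.certF j).fcomm_cert (d.isField j) hT
  have hofc : ∀ j, ord (fcomm (d.X j) T) ≤ σ := fun j => (ord_fcomm_le (d.isField j) (d.ne j) T).trans hord
  -- constants
  choose CA hCA0 hA using fun j => d.pieceA j hF hcF hε hT hpl hord
  obtain ⟨CT, hCT, hTb⟩ := hT.rn_le (t := 0) (t' := -σ) (by linarith)
  obtain ⟨CC, hCC, hC⟩ := d.lemmaC hT hpl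
  choose Cd hCd0 hCd using fun j => (show Cert (comp (d.divX j) T) from ⟨d.cert_divX j, hT⟩).rn_le
    (t := 0) (t' := -σ) (by have := (d.isCoef_divX j).ord_eq; simp only [ord_comp]; linarith)
  choose Ce hCe0 hCe using fun j => (show Cert (comp (d.divX j) (fcomm (d.X j) T)) from
    ⟨d.cert_divX j, hcfc j⟩).rn_le (t := 0) (t' := -σ)
    (by have := (d.isCoef_divX j).ord_eq; have := hofc j; simp only [ord_comp]; linarith)
  obtain ⟨Cc, hCc, hc⟩ := (show Cert (comp d.C T) from ⟨d.certC, hT⟩).rn_le (t := 0) (t' := -σ)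
    (by have := d.isCoefC.ord_eq; simp only [ord_comp]; linarith)
  obtain ⟨C0, hC00, h0⟩ := (show Cert (comp d.divX0 T) from ⟨d.cert_divX0, hT⟩).rn_le (t := 0) (t' := -σ)
    (by have := d.isCoef_divX0.ord_eq; simp only [ord_comp]; linarith)
  refine ⟨CT + 2 * CC + (∑ j, (CA j + Cd j + Ce j)) + Cc + C0,
    by have := Finset.sum_nonneg fun j (_ : j ∈ Finset.univ) => (show 0 ≤ CA j + Cd j + Ce j by
      have := hCA0 j; have := hCd0 j; have := hCe0 j; positivity); positivity, fun u hu => ?_⟩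
  set Q := d.Qx F' ε u with hQ
  have hQ0 : 0 ≤ Q := d.Qx_nonneg F' ε u
  have hG : Nice ((toSym F').apply u) := hcF.cert_toSym.nice_apply hu
  have hTu : Nice (T.apply u) := hT.nice_apply hu
  have hPu : Nice (d.opP.apply u) := d.cert_opP.nice_apply hu
  have hf : rn σ ((toSym F').apply u) ≤ Q := d.rn_F2_le_Qx hcF hε hu
  have hn : rn 0 u ≤ Q := d.rn_u_le_Qx F' ε u
  have hp : rn 0 (d.opP.apply u) ≤ Q := d.rn_P_le_Qx F' ε u
  have hsx : (∑ i, rn 0 ((d.Xs i).apply u)) ≤ Q := d.sum_rn_X_le_Qx F' ε u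
  have hx : ∀ j, rn 0 ((d.Xs j).apply u) ≤ Q := d.rn_X_le_Qx F' ε u
  have hf0 := rn_nonneg σ ((toSym F').apply u)
  -- integration by parts for `X₀`
  have hibp := Field.pairing_real d.isField0 d.certF0 d.isReal0 hTu hG
  change pairing (d.X0s.apply _) _ = -pairing _ (d.X0s.apply _) - pairing _ (d.divX0.apply _) at hibp
  rw [hibp]
  -- the `d₀` term
  have b0 : ‖pairing ((toSym F').apply u) (d.divX0.apply (T.apply u))‖ ≤ C0 * Q * Q := by
    have h := norm_pairing_le_rn σ hG ((show Cert (comp d.divX0 T) from ⟨d.cert_divX0, hT⟩).nice_apply hu)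
    rw [apply_comp] at h
    refine h.trans ?_
    have h' := h0 u hu; rw [apply_comp] at h'
    exact (mul_bound hf h' (rn_nonneg _ _) hQ0).trans (mul_le_mul_of_nonneg_left hn (mul_nonneg hC00 hQ0))
  -- `X₀ (T u) = P (T u) - sqSum (T u) - C (T u)`
  have hsq : Nice (d.sqSum.apply (T.apply u)) := d.cert_sqSum.nice_apply hTu
  have hCTu : Nice (d.C.apply (T.apply u)) := d.certC.nice_apply hTu
  have hPT : Nice (d.opP.apply (T.apply u)) := d.cert_opP.nice_apply hTu
  have hn0 := rn_nonneg 0 u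
  have hX0T : pairing ((toSym F').apply u) (d.X0s.apply (T.apply u)) =
      pairing ((toSym F').apply u) (d.opP.apply (T.apply u)) -
        pairing ((toSym F').apply u) (d.sqSum.apply (T.apply u)) -
        pairing ((toSym F').apply u) (d.C.apply (T.apply u)) := by
    rw [d.apply_X0s, pairing_sub_right (hG.inH σ) ((hPT.sub hsq).inH (-σ)) (hCTu.inH (-σ)),
      pairing_sub_right (hG.inH σ) (hPT.inH (-σ)) (hsq.inH (-σ))]
  -- the `P (T u)` term
  have bP : ‖pairing ((toSym F').apply u) (d.opP.apply (T.apply u))‖ ≤ (CT + 2 * CC) * Q * Q := by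
    have hsplit : d.opP.apply (T.apply u) =
        fun ξ => T.apply (d.opP.apply u) ξ + (Sym.comm d.opP T).apply u ξ := by
      ext ξ; simp only [apply_comm]; ring
    rw [hsplit, pairing_add_right (hG.inH σ) ((hT.nice_apply hPu).inH (-σ))
      ((((cert_comm_iff _ _).2 ⟨d.cert_opP, hT⟩).nice_apply hu).inH (-σ))]
    have b1 := (norm_pairing_le_rn σ hG (hT.nice_apply hPu)).trans
      (mul_le_mul_of_nonneg_left (hTb _ hPu) hf0)
    have b2 := (hC _ u hG hu).trans (mul_le_mul_of_nonneg_right (rn_mono hord hG)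
      (mul_nonneg hCC (add_nonneg (Finset.sum_nonneg fun _ _ => rn_nonneg _ _) (rn_nonneg _ _))))
    refine (norm_add_le _ _).trans ((add_le_add b1 b2).trans ?_)
    have hS0 := Finset.sum_nonneg fun i (_ : i ∈ Finset.univ) => rn_nonneg 0 ((d.Xs i).apply u)
    have e1 : rn σ ((toSym F').apply u) * (CT * rn 0 (d.opP.apply u)) ≤ Q * (CT * Q) :=
      mul_le_mul hf (mul_le_mul_of_nonneg_left hp hCT) (mul_nonneg hCT (rn_nonneg _ _)) hQ0
    have e2 : rn σ ((toSym F').apply u) * (CC * ((∑ i, rn 0 ((d.Xs i).apply u)) + rn 0 u)) ≤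
        Q * (CC * (Q + Q)) :=
      mul_le_mul hf (mul_le_mul_of_nonneg_left (add_le_add hsx hn) hCC)
        (mul_nonneg hCC (add_nonneg hS0 hn0)) hQ0
    nlinarith only [e1, e2]
  -- the `C (T u)` term
  have bC : ‖pairing ((toSym F').apply u) (d.C.apply (T.apply u))‖ ≤ Cc * Q * Q := by
    have h := norm_pairing_le_rn σ hG hCTu
    refine h.trans ?_
    have h' := hc u hu; rw [apply_comp] at h'
    exact (mul_bound hf h' (rn_nonneg _ _) hQ0).trans (mul_le_mul_of_nonneg_left hn (mul_nonneg hCc hQ0))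
  -- the `sqSum (T u)` term
  have bS : ‖pairing ((toSym F').apply u) (d.sqSum.apply (T.apply u))‖ ≤
      (∑ j, (CA j + Cd j + Ce j)) * Q * Q := by
    rw [d.pairing_sqSum_apply_right hG hTu]
    refine (norm_sum_le _ _).trans ?_
    rw [Finset.sum_mul, Finset.sum_mul]
    refine Finset.sum_le_sum fun j _ => ?_
    have hXTu : Nice ((d.Xs j).apply (T.apply u)) := (d.cert_Xs j).nice_apply hTu
    rw [d.pairing_Xs_right j hG hXTu]
    have bA := hA j u hu
    -- `d_j (X_j (T u)) = d_j (T (X_j u)) + d_j (fc u)`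
    have hXu : Nice ((d.Xs j).apply u) := (d.cert_Xs j).nice_apply hu
    have hsplit : (d.divX j).apply ((d.Xs j).apply (T.apply u)) =
        fun ξ => (d.divX j).apply (T.apply ((d.Xs j).apply u)) ξ +
          (d.divX j).apply ((fcomm (d.X j) T).apply u) ξ := by
      rw [d.apply_Xs_of_comm j hT hl0 hu]
      exact (d.cert_divX j).apply_add_fun (hT.nice_apply hXu) ((hcfc j).nice_apply hu)
    have hn1 : Nice ((d.divX j).apply (T.apply ((d.Xs j).apply u))) :=
      (d.cert_divX j).nice_apply (hT.nice_apply hXu)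
    have hn2 : Nice ((d.divX j).apply ((fcomm (d.X j) T).apply u)) :=
      (d.cert_divX j).nice_apply ((hcfc j).nice_apply hu)
    rw [hsplit, pairing_add_right (hG.inH σ) (hn1.inH (-σ)) (hn2.inH (-σ))]
    have b1 : ‖pairing ((toSym F').apply u) ((d.divX j).apply (T.apply ((d.Xs j).apply u)))‖ ≤
        Cd j * Q * Q := by
      refine (norm_pairing_le_rn σ hG hn1).trans ?_
      have h' := hCd j _ hXu; rw [apply_comp] at h'
      exact (mul_bound hf h' (rn_nonneg _ _) hQ0).trans
        (mul_le_mul_of_nonneg_left (hx j) (mul_nonneg (hCd0 j) hQ0))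
    have b2 : ‖pairing ((toSym F').apply u) ((d.divX j).apply ((fcomm (d.X j) T).apply u))‖ ≤
        Ce j * Q * Q := by
      refine (norm_pairing_le_rn σ hG hn2).trans ?_
      have h' := hCe j _ hu; rw [apply_comp] at h'
      exact (mul_bound hf h' (rn_nonneg _ _) hQ0).trans
        (mul_le_mul_of_nonneg_left hn (mul_nonneg (hCe0 j) hQ0))
    calc _ ≤ ‖pairing ((d.Xs j).apply ((toSym F').apply u)) ((d.Xs j).apply (T.apply u))‖ +
          (‖pairing ((toSym F').apply u) ((d.divX j).apply (T.apply ((d.Xs j).apply u)))‖ +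
            ‖pairing ((toSym F').apply u) ((d.divX j).apply ((fcomm (d.X j) T).apply u))‖) := by
          refine (norm_sub_le _ _).trans (add_le_add (by rw [norm_neg]) (norm_add_le _ _))
      _ ≤ CA j * Q ^ 2 + (Cd j * Q * Q + Ce j * Q * Q) := add_le_add bA (add_le_add b1 b2)
      _ = (CA j + Cd j + Ce j) * Q * Q := by ring
  -- collect
  rw [hX0T]
  calc _ ≤ ‖pairing ((toSym F').apply u) (d.opP.apply (T.apply u))‖ +
        ‖pairing ((toSym F').apply u) (d.sqSum.apply (T.apply u))‖ +
        ‖pairing ((toSym F').apply u) (d.C.apply (T.apply u))‖ +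
        ‖pairing ((toSym F').apply u) (d.divX0.apply (T.apply u))‖ := by
        refine (norm_sub_le _ _).trans (add_le_add ?_ le_rfl)
        rw [norm_neg]
        exact (norm_sub_le _ _).trans (add_le_add (norm_sub_le _ _) le_rfl)
    _ ≤ (CT + 2 * CC) * Q * Q + (∑ j, (CA j + Cd j + Ce j)) * Q * Q + Cc * Q * Q + C0 * Q * Q :=
        add_le_add (add_le_add (add_le_add bP bS) bC) b0
    _ = _ := by ring

/-! ### Piece C: Term II `⟨F' (X₀ u), T u⟩` (Taylor (1.44)–(1.49)) -/

/-- `F' (X_j X_j u) = X_j X_j (F' u) - X_j ([X_j,F'] u) - [X_j,F'] (X_j u)` pointwise. [folklore] -/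
theorem apply_F_sq (j : Fin d.J) {F' : Field V} (hF : IsField F') (hcF : CertF F') {u : V → ℂ}
    (hu : Nice u) :
    (toSym F').apply ((d.Xs j).apply ((d.Xs j).apply u)) = fun ξ =>
      (d.Xs j).apply ((d.Xs j).apply ((toSym F').apply u)) ξ -
        (d.Xs j).apply ((toSym (bracket (d.X j) F')).apply u) ξ -
        (toSym (bracket (d.X j) F')).apply ((d.Xs j).apply u) ξ := by
  have hX := d.isField j
  have hcX := d.certF j
  have hXu : Nice ((d.Xs j).apply u) := (d.cert_Xs j).nice_apply hu
  have h1 := Field.apply_swap hX hcX hF hcF hXu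
  have h2 := Field.apply_swap hX hcX hF hcF hu
  have hcB : Cert (toSym (bracket (d.X j) F')) := (hcX.bracket hX hF hcF).cert_toSym
  have h3 := (d.cert_Xs j).apply_sub_fun (((d.cert_Xs j)).nice_apply (hcF.cert_toSym.nice_apply hu))
    (hcB.nice_apply hu)
  unfold Xs at *
  rw [h1]
  ext ξ
  have h2' : (toSym (d.X j)).apply ((toSym F').apply ((toSym (d.X j)).apply u)) =
      (toSym (d.X j)).apply (fun ξ => (toSym (d.X j)).apply ((toSym F').apply u) ξ -
        (toSym (bracket (d.X j) F')).apply u ξ) := by rw [h2]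
  rw [h2', h3]

/-- **Term II** (Taylor (1.49)): for plain certified `T` with `ord T ≤ 2ε - 1 ≤ 0`,
`|⟨F' (X₀ u), T u⟩| ≤ C · Q(u)²`. [folklore] -/
theorem termII {F' : Field V} (hF : IsField F') (hcF : CertF F') (hr : IsReal F') (hne : F' ≠ [])
    {ε : ℝ} (hε : 0 ≤ ε) (hε2 : 2 * ε ≤ 1)
    {T : Sym V} (hT : Cert T) (hpl : Plain T) (hord : ord T ≤ 2 * ε - 1) :
    ∃ C : ℝ, 0 ≤ C ∧ ∀ u : V → ℂ, Nice u →
      ‖pairing ((toSym F').apply (d.X0s.apply u)) (T.apply u)‖ ≤ C * d.Qx F' ε u ^ 2 := by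
  set σ : ℝ := 2 * ε - 1 with hσ
  have hσ0 : σ ≤ 0 := by rw [hσ]; linarith
  have hl0 : lev T ≤ 1 := by simp [hpl.lev_eq]
  have hcFs := hcF.cert_toSym
  -- bracket fields `F~_j = [X_j, F']`
  have hBi : ∀ j, IsField (bracket (d.X j) F') := fun j => (d.isField j).bracket hF
  have hBc : ∀ j, CertF (bracket (d.X j) F') := fun j => (d.certF j).bracket (d.isField j) hF hcF
  have hBr : ∀ j, IsReal (bracket (d.X j) F') := fun j => (d.isReal j).bracket hr
  have hBne : ∀ j, bracket (d.X j) F' ≠ [] := fun j => bracket_ne_nil (d.ne j) hne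
  -- constants
  obtain ⟨CB, hCB, hB⟩ := lemmaB hF hcF hr hne hT hl0 hord hσ0
  obtain ⟨Cc, hCc, hc⟩ := d.certC.rn_le (t := 0) (t' := 0) (by rw [d.isCoefC.ord_eq]; simp)
  choose CA hCA0 hA using fun j => d.pieceA j hF hcF hε hT hpl hord
  choose CD hCD0 hD using fun j => lemmaA (d.isField j) (d.certF j) (d.isReal j) (d.ne j)
    (show Cert (comp (d.divX j) T) from ⟨d.cert_divX j, hT⟩)
    (by simp [(d.isCoef_divX j).lev_eq, hpl.lev_eq])
    (show ord (comp (d.divX j) T) ≤ σ by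
      have := (d.isCoef_divX j).ord_eq; simp only [ord_comp]; linarith)
  choose CE hCE0 hE using fun j => lemmaA (d.isField j) (d.certF j) (d.isReal j) (d.ne j) hT hl0 hord
  choose CF hCF0 hFb using fun j => lemmaB (hBi j) (hBc j) (hBr j) (hBne j) hT hl0 hord hσ0
  refine ⟨2 * (CB + Cc * CB + ∑ j, (CA j + CD j + CE j + CF j)),
    by have := Finset.sum_nonneg fun j (_ : j ∈ Finset.univ) => (show 0 ≤ CA j + CD j + CE j + CF j by
      have := hCA0 j; have := hCD0 j; have := hCE0 j; have := hCF0 j; positivity); positivity,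
    fun u hu => ?_⟩
  set Q := d.Qx F' ε u with hQ
  have hQ0 : 0 ≤ Q := d.Qx_nonneg F' ε u
  have hG : Nice ((toSym F').apply u) := hcFs.nice_apply hu
  have hTu : Nice (T.apply u) := hT.nice_apply hu
  have hPu : Nice (d.opP.apply u) := d.cert_opP.nice_apply hu
  have hCu : Nice (d.C.apply u) := d.certC.nice_apply hu
  have hSu : Nice (d.sqSum.apply u) := d.cert_sqSum.nice_apply hu
  have hf : rn σ ((toSym F').apply u) ≤ Q := d.rn_F2_le_Qx hcF hε hu
  have hn : rn 0 u ≤ Q := d.rn_u_le_Qx F' ε u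
  have hp : rn 0 (d.opP.apply u) ≤ Q := d.rn_P_le_Qx F' ε u
  have hx : ∀ j, rn 0 ((d.Xs j).apply u) ≤ Q := d.rn_X_le_Qx F' ε u
  have hb : ∀ j, rn σ ((toSym (bracket (d.X j) F')).apply u) ≤ Q := d.rn_br_le_Qx F' ε u
  have hf0 := rn_nonneg σ ((toSym F').apply u)
  have hn0 := rn_nonneg 0 u
  -- `F' (X₀ u) = F' (P u) - F' (sqSum u) - F' (C u)`
  have hsplit : (toSym F').apply (d.X0s.apply u) = fun ξ =>
      (toSym F').apply (d.opP.apply u) ξ - (toSym F').apply (d.sqSum.apply u) ξ -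
        (toSym F').apply (d.C.apply u) ξ := by
    rw [d.apply_X0s u, hcFs.apply_sub_fun (hPu.sub hSu) hCu, hcFs.apply_sub_fun hPu hSu]
  have hN1 : Nice ((toSym F').apply (d.opP.apply u)) := hcFs.nice_apply hPu
  have hN2 : Nice ((toSym F').apply (d.sqSum.apply u)) := hcFs.nice_apply hSu
  have hN3 : Nice ((toSym F').apply (d.C.apply u)) := hcFs.nice_apply hCu
  rw [hsplit, pairing_sub_left ((hN1.sub hN2).inH 0) (hN3.inH 0) (by simpa using hTu.inH 0),
    pairing_sub_left (hN1.inH 0) (hN2.inH 0) (by simpa using hTu.inH 0)]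
  -- the `P u` term (Lemma B)
  have bP : ‖pairing ((toSym F').apply (d.opP.apply u)) (T.apply u)‖ ≤ Q * (CB * (Q + Q)) :=
    (hB _ u hPu hu).trans (mul_le_mul hp (mul_le_mul_of_nonneg_left (add_le_add hf hn) hCB)
      (mul_nonneg hCB (add_nonneg hf0 hn0)) hQ0)
  -- the `C u` term (Lemma B)
  have bC : ‖pairing ((toSym F').apply (d.C.apply u)) (T.apply u)‖ ≤ Cc * CB * (Q * (Q + Q)) := by
    refine (hB _ u hCu hu).trans ?_
    have h1 : rn 0 (d.C.apply u) ≤ Cc * Q := (hc u hu).trans (mul_le_mul_of_nonneg_left hn hCc)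
    calc rn 0 (d.C.apply u) * (CB * (rn σ ((toSym F').apply u) + rn 0 u))
        ≤ (Cc * Q) * (CB * (Q + Q)) := mul_le_mul h1 (mul_le_mul_of_nonneg_left (add_le_add hf hn) hCB)
          (mul_nonneg hCB (add_nonneg hf0 hn0)) (mul_nonneg hCc hQ0)
      _ = Cc * CB * (Q * (Q + Q)) := by ring
  -- the `sqSum u` term
  have bS : ‖pairing ((toSym F').apply (d.sqSum.apply u)) (T.apply u)‖ ≤
      (∑ j, (CA j + CD j + CE j + CF j)) * (Q * (Q + Q)) := by
    -- `F' (sqSum u) = ∑_j F' (X_j X_j u)`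
    have hcl : ∀ s ∈ List.ofFn (fun j : Fin d.J => comp (d.Xs j) (d.Xs j)), Cert s := by
      intro s hs; obtain ⟨j, rfl⟩ := List.mem_ofFn.1 hs; exact ⟨d.cert_Xs j, d.cert_Xs j⟩
    have hsc := sum_comp_left hcFs hcl u hu
    simp only [apply_comp] at hsc
    change (toSym F').apply (d.sqSum.apply u) = _ at hsc
    rw [hsc, List.map_ofFn, pairing_sum_apply (fun s hs => ?_) hu hTu, List.map_ofFn, Fin.sum_ofFn]
    swap
    · obtain ⟨j, rfl⟩ := List.mem_ofFn.1 hs; exact ⟨hcFs, d.cert_Xs j, d.cert_Xs j⟩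
    refine (norm_sum_le _ _).trans ?_
    rw [Finset.sum_mul]
    refine Finset.sum_le_sum fun j _ => ?_
    simp only [Function.comp, apply_comp]
    rw [d.apply_F_sq j hF hcF hu]
    have hXG : Nice ((d.Xs j).apply ((toSym F').apply u)) := (d.cert_Xs j).nice_apply hG
    have hXXG : Nice ((d.Xs j).apply ((d.Xs j).apply ((toSym F').apply u))) := (d.cert_Xs j).nice_apply hXG
    have hBu : Nice ((toSym (bracket (d.X j) F')).apply u) := (hBc j).cert_toSym.nice_apply hu
    have hXBu : Nice ((d.Xs j).apply ((toSym (bracket (d.X j) F')).apply u)) := (d.cert_Xs j).nice_apply hBu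
    have hXu : Nice ((d.Xs j).apply u) := (d.cert_Xs j).nice_apply hu
    have hBXu : Nice ((toSym (bracket (d.X j) F')).apply ((d.Xs j).apply u)) :=
      (hBc j).cert_toSym.nice_apply hXu
    rw [pairing_sub_left ((hXXG.sub hXBu).inH 0) (hBXu.inH 0) (by simpa using hTu.inH 0),
      pairing_sub_left (hXXG.inH 0) (hXBu.inH 0) (by simpa using hTu.inH 0)]
    -- (a) `⟨X_j X_j G, T u⟩ = -⟨X_j G, X_j T u⟩ - ⟨X_j G, d_j T u⟩`
    have ha : ‖pairing ((d.Xs j).apply ((d.Xs j).apply ((toSym F').apply u))) (T.apply u)‖ ≤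
        CA j * Q ^ 2 + CD j * (Q * (Q + Q)) := by
      have h := Field.pairing_real (d.isField j) (d.certF j) (d.isReal j) hTu hXG
      change pairing ((d.Xs j).apply _) _ = -pairing _ ((d.Xs j).apply _) - pairing _ ((d.divX j).apply _) at h
      rw [h]
      have b1 := hA j u hu
      have b2 := hD j _ u hG hu
      rw [apply_comp] at b2
      refine (norm_sub_le _ _).trans (add_le_add (by rwa [norm_neg]) (b2.trans ?_))
      exact (mul_le_mul hf (mul_le_mul_of_nonneg_left (add_le_add (hx j) hn) (hCD0 j))
        (mul_nonneg (hCD0 j) (add_nonneg (rn_nonneg _ _) hn0)) hQ0).trans_eq (by ring)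
    -- (b) `⟨X_j (F~ u), T u⟩` by Lemma A with `G = F~ u`
    have hb' : ‖pairing ((d.Xs j).apply ((toSym (bracket (d.X j) F')).apply u)) (T.apply u)‖ ≤
        CE j * (Q * (Q + Q)) := by
      have b := hE j _ u hBu hu
      refine b.trans (mul_le_mul (hb j) (mul_le_mul_of_nonneg_left (add_le_add (hx j) hn) (hCE0 j))
        (mul_nonneg (hCE0 j) (add_nonneg (rn_nonneg _ _) hn0)) hQ0) |>.trans ?_
      exact le_of_eq (by ring)
    -- (c) `⟨F~ (X_j u), T u⟩` by Lemma B for `F~`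
    have hc' : ‖pairing ((toSym (bracket (d.X j) F')).apply ((d.Xs j).apply u)) (T.apply u)‖ ≤
        CF j * (Q * (Q + Q)) := by
      have b := hFb j _ u hXu hu
      refine b.trans (mul_le_mul (hx j) (mul_le_mul_of_nonneg_left (add_le_add (hb j) hn) (hCF0 j))
        (mul_nonneg (hCF0 j) (add_nonneg (rn_nonneg _ _) hn0)) hQ0) |>.trans ?_
      exact le_of_eq (by ring)
    calc _ ≤ ‖pairing ((d.Xs j).apply ((d.Xs j).apply ((toSym F').apply u))) (T.apply u)‖ +
          ‖pairing ((d.Xs j).apply ((toSym (bracket (d.X j) F')).apply u)) (T.apply u)‖ +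
          ‖pairing ((toSym (bracket (d.X j) F')).apply ((d.Xs j).apply u)) (T.apply u)‖ :=
          (norm_sub_le _ _).trans (add_le_add (norm_sub_le _ _) le_rfl)
      _ ≤ CA j * Q ^ 2 + CD j * (Q * (Q + Q)) + CE j * (Q * (Q + Q)) + CF j * (Q * (Q + Q)) :=
          add_le_add (add_le_add ha hb') hc'
      _ ≤ (CA j + CD j + CE j + CF j) * (Q * (Q + Q)) := by
          nlinarith only [mul_nonneg (hCA0 j) (sq_nonneg Q)]
  calc _ ≤ ‖pairing ((toSym F').apply (d.opP.apply u)) (T.apply u)‖ +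
        ‖pairing ((toSym F').apply (d.sqSum.apply u)) (T.apply u)‖ +
        ‖pairing ((toSym F').apply (d.C.apply u)) (T.apply u)‖ :=
        (norm_sub_le _ _).trans (add_le_add (norm_sub_le _ _) le_rfl)
    _ ≤ Q * (CB * (Q + Q)) + (∑ j, (CA j + CD j + CE j + CF j)) * (Q * (Q + Q)) +
        Cc * CB * (Q * (Q + Q)) := add_le_add (add_le_add bP bS) bC
    _ = 2 * (CB + Cc * CB + ∑ j, (CA j + CD j + CE j + CF j)) * Q ^ 2 := by ring

/-! ### The `X₀`-step -/

/-- **The `X₀`-step** (Taylor (1.50)): `S(F', ε')` with `0 < ε' ≤ 1` implies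
`S([X₀, F'], ε'/4)`. [folklore] -/
theorem stepX0 {F' : Field V} (hF : IsField F') (hcF : CertF F') (hr : IsReal F')
    (hne : F' ≠ []) {ε' : ℝ} (hε' : 0 < ε') (hε'1 : ε' ≤ 1) (IH : d.KohnS F' ε') :
    d.KohnS (bracket d.X0 F') (ε' / 4) := by
  set ε : ℝ := ε' / 4 with hε
  have hε0 : 0 ≤ ε := by rw [hε]; linarith
  have hε2 : 2 * ε ≤ 1 := by rw [hε]; linarith
  set F : Field V := bracket d.X0 F' with hFdef
  have hFi : IsField F := d.isField0.bracket hF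
  have hcFb : CertF F := d.certF0.bracket d.isField0 hF hcF
  have hcFs := hcFb.cert_toSym
  set T : Sym V := comp (bessel (2 * ε - 2)) (toSym F) with hT
  have hcT : Cert T := ⟨trivial, hcFs⟩
  have hplT : Plain T := ⟨trivial, hFi.plain_toSym⟩
  have hordT : ord T ≤ 2 * ε - 1 := by
    have := hFi.ord_toSym_le; simp only [hT, ord_comp, ord_bessel]; linarith
  obtain ⟨C₁, hC₁, h₁⟩ := d.termI hF hcF hε0 hcT hplT hordT
  obtain ⟨C₂, hC₂, h₂⟩ := d.termII hF hcF hr hne hε0 hε2 hcT hplT hordT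
  obtain ⟨CI, hCI, hI⟩ := IH
  obtain ⟨K, hK, hKx⟩ := d.sum_rn_Xs_le
  choose CJ hCJ0 hJ using fun j => d.stepJ j hF hcF hr hne hε' hε'1 ⟨CI, hCI, hI⟩
  have hSJ : 0 ≤ ∑ j, CJ j := Finset.sum_nonneg fun j _ => hCJ0 j
  refine ⟨Real.sqrt (C₁ + C₂) * (2 + CI + K + ∑ j, CJ j), by positivity, fun u hu => ?_⟩
  have hG : Nice ((toSym F').apply u) := hcF.cert_toSym.nice_apply hu
  have hFu : Nice ((toSym F).apply u) := hcFs.nice_apply hu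
  have hX0u : Nice (d.X0s.apply u) := d.cert_X0s.nice_apply hu
  -- `F u = X₀ (F' u) - F' (X₀ u)`
  have hbr := comm_toSym d.isField0 d.certF0 hF hcF u hu
  rw [apply_comm] at hbr
  have hid : rn (ε - 1) ((toSym F).apply u) ^ 2 =
      (pairing (d.X0s.apply ((toSym F').apply u)) (T.apply u)).re -
        (pairing ((toSym F').apply (d.X0s.apply u)) (T.apply u)).re := by
    rw [rn_sq_eq_re_pairing hFu ε, ← Complex.sub_re, ← pairing_sub_left
      ((d.cert_X0s.nice_apply hG).inH 0) ((hcF.cert_toSym.nice_apply hX0u).inH 0)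
      (by simpa using (hcT.nice_apply hu).inH 0)]
    have hTu' : (Sym.bessel (2 * ε - 2)).apply ((toSym F).apply u) = T.apply u := rfl
    have hFu' : (toSym F).apply u =
        fun ξ => d.X0s.apply ((toSym F').apply u) ξ - (toSym F').apply (d.X0s.apply u) ξ := by
      rw [hFdef, ← hbr]
    rw [hTu', hFu']
  set Q := d.Qx F' ε u with hQ
  have hQ0 : 0 ≤ Q := d.Qx_nonneg F' ε u
  set y := rn (ε - 1) ((toSym F).apply u) with hy
  have hy0 : 0 ≤ y := rn_nonneg _ _
  have hy2 : y ^ 2 ≤ (C₁ + C₂) * Q ^ 2 := by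
    rw [hid]
    have b1 := (abs_re_le_norm _).trans (h₁ u hu)
    have b2 := (abs_re_le_norm _).trans (h₂ u hu)
    have a1 := le_abs_self (pairing (d.X0s.apply ((toSym F').apply u)) (T.apply u)).re
    have a2 := neg_abs_le (pairing ((toSym F').apply (d.X0s.apply u)) (T.apply u)).re
    nlinarith only [b1, b2, a1, a2]
  have hy4 : y ≤ Real.sqrt (C₁ + C₂) * Q := le_sqrt_mul_of_sq_le hy0 hQ0 (add_nonneg hC₁ hC₂) hy2
  -- `Q ≤ (2 + CI + K + ∑ CJ) (p + n)`
  set p := rn 0 (d.opP.apply u) with hp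
  set n := rn 0 u with hn
  have hp0 : 0 ≤ p := rn_nonneg _ _
  have hn0 : 0 ≤ n := rn_nonneg _ _
  have hf4 : rn (4 * ε - 1) ((toSym F').apply u) ≤ CI * (p + n) := by
    have := hI u hu; rwa [show ε' - 1 = 4 * ε - 1 by rw [hε]; ring] at this
  have hsx : (∑ j, rn 0 ((d.Xs j).apply u)) ≤ K * (p + n) := hKx u hu
  have hsb : (∑ j, rn (2 * ε - 1) ((toSym (bracket (d.X j) F')).apply u)) ≤ (∑ j, CJ j) * (p + n) := by
    rw [Finset.sum_mul]
    refine Finset.sum_le_sum fun j _ => ?_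
    have := hJ j u hu
    rwa [show ε' / 2 - 1 = 2 * ε - 1 by rw [hε]; ring] at this
  have hQle : Q ≤ (2 + CI + K + ∑ j, CJ j) * (p + n) := by
    have hQdef : Q = p + n + rn (4 * ε - 1) ((toSym F').apply u) +
        (∑ j, rn 0 ((d.Xs j).apply u)) + ∑ j, rn (2 * ε - 1) ((toSym (bracket (d.X j) F')).apply u) := rfl
    rw [hQdef]
    have e : (2 + CI + K + ∑ j, CJ j) * (p + n) =
        2 * (p + n) + CI * (p + n) + K * (p + n) + (∑ j, CJ j) * (p + n) := by ring
    rw [e]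
    linarith
  calc y ≤ Real.sqrt (C₁ + C₂) * Q := hy4
    _ ≤ Real.sqrt (C₁ + C₂) * ((2 + CI + K + ∑ j, CJ j) * (p + n)) :=
        mul_le_mul_of_nonneg_left hQle (Real.sqrt_nonneg _)
    _ = _ := by ring

/-! ### The base case `S(X₀, 1/2)` -/

/-- **Base case** `S(X₀, 1/2)` (Taylor (1.52)): `‖X₀ u‖_{-1/2} ≤ C (‖Pu‖₀ + ‖u‖₀)`. [folklore] -/
theorem kohnS_X0 : d.KohnS d.X0 (1 / 2) := by
  set T : Sym V := comp (bessel (-1)) d.X0s with hT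
  have hcT : Cert T := ⟨trivial, d.cert_X0s⟩
  have hoT : ord T ≤ 0 := by
    have := d.isField0.ord_toSym_le; simp only [hT, ord_comp, ord_bessel, X0s]; linarith
  have hl0 : lev T ≤ 1 := by simp [hT, d.plain_X0s.lev_eq]
  -- constants
  obtain ⟨C₁, hC₁, h₁⟩ := hcT.rn_le (t := 0) (t' := 0) (by linarith)
  obtain ⟨Cc, hCc, hc⟩ := d.certC.rn_le (t := 0) (t' := 0) (by rw [d.isCoefC.ord_eq]; simp)
  choose Cf hCf0 hf using fun j => ((d.certF j).fcomm_cert (d.isField j) hcT).rn_le (t := 0) (t' := 0)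
    (by have := ord_fcomm_le (d.isField j) (d.ne j) T; linarith)
  choose Cd hCd0 hdd using fun j => (show Cert (comp (d.divX j) T) from ⟨d.cert_divX j, hcT⟩).rn_le
    (t := 0) (t' := 0) (by have := (d.isCoef_divX j).ord_eq; simp only [ord_comp]; linarith)
  obtain ⟨K, hK, hKx⟩ := d.sum_rn_Xs_le
  have hS0' : 0 ≤ ∑ j, (C₁ + Cf j + Cd j) := Finset.sum_nonneg fun j _ => by
    have := hCf0 j; have := hCd0 j; positivity
  set A : ℝ := C₁ + Cc * C₁ + ∑ j, (C₁ + Cf j + Cd j) with hA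
  have hA0 : 0 ≤ A := by positivity
  refine ⟨Real.sqrt A * (1 + K), by positivity, fun u hu => ?_⟩
  have hX0u : Nice (d.X0s.apply u) := d.cert_X0s.nice_apply hu
  have hTu : Nice (T.apply u) := hcT.nice_apply hu
  have hPu : Nice (d.opP.apply u) := d.cert_opP.nice_apply hu
  have hCu : Nice (d.C.apply u) := d.certC.nice_apply hu
  have hSu : Nice (d.sqSum.apply u) := d.cert_sqSum.nice_apply hu
  set p := rn 0 (d.opP.apply u) with hp
  set n := rn 0 u with hn
  have hp0 : 0 ≤ p := rn_nonneg _ _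
  have hn0 : 0 ≤ n := rn_nonneg _ _
  have hTn : rn 0 (T.apply u) ≤ C₁ * n := h₁ u hu
  -- `‖X₀u‖_{-1/2}² = Re ⟨X₀ u, T u⟩`
  have hid : rn (1 / 2 - 1) ((toSym d.X0).apply u) ^ 2 = (pairing (d.X0s.apply u) (T.apply u)).re := by
    have h := rn_sq_eq_re_pairing hX0u (1 / 2)
    rw [show (2 : ℝ) * (1 / 2) - 2 = -1 by norm_num] at h
    exact h
  -- split `X₀ u = P u - sqSum u - C u`
  have hsplit : pairing (d.X0s.apply u) (T.apply u) = pairing (d.opP.apply u) (T.apply u) -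
      pairing (d.sqSum.apply u) (T.apply u) - pairing (d.C.apply u) (T.apply u) := by
    rw [d.apply_X0s u, pairing_sub_left ((hPu.sub hSu).inH 0) (hCu.inH 0) (by simpa using hTu.inH 0),
      pairing_sub_left (hPu.inH 0) (hSu.inH 0) (by simpa using hTu.inH 0)]
  have bP : ‖pairing (d.opP.apply u) (T.apply u)‖ ≤ p * (C₁ * n) := by
    have h := norm_pairing_le_rn 0 hPu hTu
    rw [neg_zero] at h
    exact h.trans (mul_le_mul_of_nonneg_left hTn hp0)
  have bC : ‖pairing (d.C.apply u) (T.apply u)‖ ≤ (Cc * n) * (C₁ * n) := by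
    have h := norm_pairing_le_rn 0 hCu hTu
    rw [neg_zero] at h
    exact h.trans (mul_le_mul (hc u hu) hTn (rn_nonneg _ _) (mul_nonneg hCc hn0))
  set x : Fin d.J → ℝ := fun j => rn 0 ((d.Xs j).apply u) with hx
  have hx0 : ∀ j, 0 ≤ x j := fun j => rn_nonneg _ _
  have bS : ‖pairing (d.sqSum.apply u) (T.apply u)‖ ≤ ∑ j, x j * ((C₁ + Cf j + Cd j) * (x j + n)) := by
    rw [d.pairing_sqSum_apply hu hTu]
    refine (norm_sum_le _ _).trans (Finset.sum_le_sum fun j _ => ?_)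
    have hXu : Nice ((d.Xs j).apply u) := (d.cert_Xs j).nice_apply hu
    have h := Field.pairing_real (d.isField j) (d.certF j) (d.isReal j) hTu hXu
    change pairing ((d.Xs j).apply _) _ = -pairing _ ((d.Xs j).apply _) - pairing _ ((d.divX j).apply _) at h
    rw [h]
    have hXT : Nice ((d.Xs j).apply (T.apply u)) := (d.cert_Xs j).nice_apply hTu
    have hdT : Nice ((d.divX j).apply (T.apply u)) := (d.cert_divX j).nice_apply hTu
    -- `‖X_j (T u)‖₀ ≤ C₁ x_j + Cf n`
    have hXTn : rn 0 ((d.Xs j).apply (T.apply u)) ≤ C₁ * x j + Cf j * n := by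
      rw [d.apply_Xs_of_comm j hcT hl0 hu]
      refine (rn_add_le 0 (hcT.nice_apply hXu) (((d.certF j).fcomm_cert (d.isField j) hcT).nice_apply hu)).trans ?_
      exact add_le_add (h₁ _ hXu) (hf j u hu)
    have hdTn : rn 0 ((d.divX j).apply (T.apply u)) ≤ Cd j * n := by
      have := hdd j u hu; rwa [apply_comp] at this
    have b1 := norm_pairing_le_rn 0 hXu hXT
    have b2 := norm_pairing_le_rn 0 hXu hdT
    rw [neg_zero] at b1 b2
    calc _ ≤ ‖pairing ((d.Xs j).apply u) ((d.Xs j).apply (T.apply u))‖ +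
          ‖pairing ((d.Xs j).apply u) ((d.divX j).apply (T.apply u))‖ :=
          (norm_sub_le _ _).trans (add_le_add (by rw [norm_neg]) le_rfl)
      _ ≤ x j * (C₁ * x j + Cf j * n) + x j * (Cd j * n) :=
          add_le_add (b1.trans (mul_le_mul_of_nonneg_left hXTn (hx0 j)))
            (b2.trans (mul_le_mul_of_nonneg_left hdTn (hx0 j)))
      _ ≤ _ := by
          have h0 : 0 ≤ x j * (C₁ * n + Cf j * x j + Cd j * x j) :=
            mul_nonneg (hx0 j) (add_nonneg (add_nonneg (mul_nonneg hC₁ hn0)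
              (mul_nonneg (hCf0 j) (hx0 j))) (mul_nonneg (hCd0 j) (hx0 j)))
          nlinarith only [h0]
  -- `y² ≤ A (p + n + ∑ x)²`
  set s := ∑ j, x j with hs
  have hs0 : 0 ≤ s := Finset.sum_nonneg fun j _ => hx0 j
  have hxs : ∀ j, x j ≤ s := fun j =>
    Finset.single_le_sum (f := x) (fun j _ => hx0 j) (Finset.mem_univ j)
  have bS' : ‖pairing (d.sqSum.apply u) (T.apply u)‖ ≤ (∑ j, (C₁ + Cf j + Cd j)) * (s * (s + n)) := by
    refine bS.trans ?_
    rw [Finset.sum_mul]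
    refine Finset.sum_le_sum fun j _ => ?_
    have := hxs j; have := hx0 j; have := hCf0 j; have := hCd0 j
    calc x j * ((C₁ + Cf j + Cd j) * (x j + n)) = (C₁ + Cf j + Cd j) * (x j * (x j + n)) := by ring
      _ ≤ (C₁ + Cf j + Cd j) * (s * (s + n)) :=
          mul_le_mul_of_nonneg_left (mul_le_mul (hxs j) (add_le_add (hxs j) le_rfl)
            (add_nonneg (hx0 j) hn0) hs0) (by have := hCf0 j; have := hCd0 j; positivity)
  have hS0 := hS0'
  set y := rn (1 / 2 - 1) ((toSym d.X0).apply u) with hy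
  have hy0 : 0 ≤ y := rn_nonneg _ _
  have hy2 : y ^ 2 ≤ A * (p + n + s) ^ 2 := by
    rw [hid, hsplit]
    have h := (abs_re_le_norm _).trans ((norm_sub_le _ _).trans
      (add_le_add ((norm_sub_le _ _).trans (add_le_add bP bS')) bC))
    have this := le_abs_self (pairing (d.opP.apply u) (T.apply u) - pairing (d.sqSum.apply u) (T.apply u) -
      pairing (d.C.apply u) (T.apply u)).re
    have e1 : p * (C₁ * n) ≤ C₁ * (p + n + s) ^ 2 := by
      have : p * n ≤ (p + n + s) ^ 2 := by
        nlinarith only [mul_nonneg hp0 hs0, mul_nonneg hn0 hs0, mul_nonneg hp0 hn0, sq_nonneg p,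
          sq_nonneg n, sq_nonneg s]
      nlinarith only [mul_le_mul_of_nonneg_left this hC₁]
    have e2 : (∑ j, (C₁ + Cf j + Cd j)) * (s * (s + n)) ≤ (∑ j, (C₁ + Cf j + Cd j)) * (p + n + s) ^ 2 := by
      refine mul_le_mul_of_nonneg_left ?_ hS0
      nlinarith only [mul_nonneg hp0 hs0, mul_nonneg hn0 hs0, mul_nonneg hp0 hn0, sq_nonneg p,
        sq_nonneg n, sq_nonneg s]
    have e3 : Cc * n * (C₁ * n) ≤ Cc * C₁ * (p + n + s) ^ 2 := by
      have : n * n ≤ (p + n + s) ^ 2 := by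
        nlinarith only [mul_nonneg hp0 hs0, mul_nonneg hn0 hs0, mul_nonneg hp0 hn0, sq_nonneg p,
          sq_nonneg n, sq_nonneg s]
      nlinarith only [mul_le_mul_of_nonneg_left this (mul_nonneg hCc hC₁)]
    rw [hA]
    nlinarith only [e1, e2, e3, h, this]
  have hy4 : y ≤ Real.sqrt A * (p + n + s) :=
    le_sqrt_mul_of_sq_le hy0 (add_nonneg (add_nonneg hp0 hn0) hs0) hA0 hy2
  have hsK : s ≤ K * (p + n) := hKx u hu
  calc y ≤ Real.sqrt A * (p + n + s) := hy4
    _ ≤ Real.sqrt A * ((1 + K) * (p + n)) :=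
        mul_le_mul_of_nonneg_left (by nlinarith only [hsK, hp0, hn0]) (Real.sqrt_nonneg A)
    _ = _ := by ring

end HData

end Literature.Analysis.Hypoelliptic
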